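import Literature.NumberTheory.EllipticCurves.HeegnerPointsOfConductor
import Literature.NumberTheory.EllipticCurves.HeegnerPointsKolyvaginEulerSystem
import Literature.NumberTheory.EllipticCurves.ModularCurve
import Literature.NumberTheory.EllipticCurves.Isogeny
import Literature.NumberTheory.EllipticCurves.QuadraticTwist
import Literature.NumberTheory.EllipticCurves.Selmer
import Literature.NumberTheory.EllipticCurves.Rank1Residual.Predicates
import HarnessLib

/-!
# Crux U1 `KolyvaginBoundedDefectAtTwo` (stmt-BirchSwinnertonDyer-28083), route `KolyvaginRankRigidityAtTwo` — DEFINITIONS: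
# the CORANK-ONE RESTRICTIONS of U1 / V1′∞ and the node «`y_K` non-torsion on corank-one Heegner frames» (the 2-converse over `K`),
# VERBATIM from the pen's kernel-checked sketch `Cruxes/KolyvaginBoundedDefectAtTwo/TwistCongruenceCorankOneSketch.lean` (v2, bsd-idea-1 g19;
# critic idea-crit-5 #364b census: U1|c1 7cee18ac3fb0a4a2, HNT|c1 378d5ad2189095ea, V1|c1 f275e594e8b9fee2)

Width seat `bsd-line-krr2-p2` g20 (ONE READER on LINE 17).  DEFINITIONS ONLY (`def … : Prop`, bodies token-identical to the pen's sketch, so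
that the corank-one collapse — `Theorems/KolyvaginRankRigidityAtTwoCorankOneCollapse.lean`, `--supports stmt-BirchSwinnertonDyer-28083` — can
be landed BY NAME instead of living only under `Cruxes/`).  Nothing is asserted or proved here.  All three statements are OPEN (they are
`@[conjecture]` obligation nodes, never Literature facts): `HeegnerNonTorsionAtTwoCorankOne` is the rank-one 2-CONVERSE OVER `K` on the route's
habitat (non-CM, full 2-adic image) — beyond print at `p = 2` (Skinner / W. Zhang / BCGS need `p` odd; pen's ENGINE-CENSUS-g20) —, and the two
restrictions inherit the open content of U1 (stmt-28083) / V1′∞ (stmt-27983) on corank-one frames.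
No summit / crux / rung is proved by filing definitions.  **BSD is NOT proved.**

The «corank-one frames» are U1's frames (habitat `W` non-CM, good-ordinary-or-multiplicative at `2`, `ρ_{E,2^m}` onto `∀ m`; `K` imaginary
quadratic, Heegner for `N`, `d_K` odd `≠ −3`, `E(K)[2] = 0`, `2` split; any `(Dt, β, ι)` with `4N ∣ β² − d_K`) carrying the extra hypothesis
`corank_{ℤ₂} Sel_{2^∞}(E/ℚ) + corank_{ℤ₂} Sel_{2^∞}(E^{(d_K)}/ℚ) = 1` — the form in which the route's deciding theorem `closes` PRODUCES its
frames (`0 + 1` in its `r = 0` branch via BFH + Gross–Zagier–Kolyvagin, `1 + 0` in its `r = 1` branch via Hoffstein–Luo + Kato).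
References (locators only): [cite: Kolyvagin1991MathAnn, §2 (2.1), Conj. 2.5] [cite: GrossZagier1986, Thm. I.6.3 with V.§2] [cite: GrossLMS1991, §4 (4.1)]
[cite: WZhang2014, Thm. 1.1, Thm. 1.3].
-/

set_option autoImplicit false
-- the Theorems namespace of this sub repeats the summit name by design (D-0017 nested layout)
set_option linter.dupNamespace false

noncomputable section

open scoped Classical
open WeierstrassCurve Field Literature.NumberTheory.EllipticCurves

namespace Summit.BirchSwinnertonDyer.BirchSwinnertonDyer.Theorems.KolyvaginAtTwo.CorankOne

/-- **U1|c1 — U1 (`Theses.KolyvaginRankRigidityAtTwo.KolyvaginBoundedDefectAtTwo`, stmt-BirchSwinnertonDyer-28083) restricted to the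
corank-one frames**: the item's binders VERBATIM plus the hypothesis `W.selmerCorank 2 + (W.quadraticTwist d_K).selmerCorank 2 = 1`, same
conclusion (a depth `r` and a defect bound `m` with, at every level `M > m`, a Kolyvagin conductor `n` of depth `r`, `M ≤ M(n)`, carrying
`2^(M−m−1)·c_M(n) ≠ 0`).  OPEN (implied by U1: `CorankOne.corankOne_of_boundedDefect`; implied AT DEPTH 0 by `HeegnerNonTorsionAtTwoCorankOne`:
`CorankOne.corankOne_of_heegnerNonTorsion`).  Pen bsd-idea-1 g19's text, token-identical.
[cite: Kolyvagin1991MathAnn, §2 (2.1), Conj. 2.5] [cite: WZhang2014, Thm. 1.1] -/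
@[conjecture] def KolyvaginBoundedDefectAtTwoCorankOne : Prop :=
  ∀ (W : WeierstrassCurve ℚ) [W.IsElliptic] [W.IsGloballyMinimal], ¬ W.HasCM →
    (Rank1Residual.GoodOrd W 2 ∨ Rank1Residual.Mult W 2) →
    (∀ m : ℕ, W.HasSurjectiveModNGaloisRep (2 ^ m : ℕ)) →
    ∀ (K : Type) [Field K] [NumberField K], IsImaginaryQuadratic K →
    ∀ [NeZero (W.conductorNorm ℤ)],
    SatisfiesHeegnerHypothesis (W.conductorNorm ℤ) K →
    Odd (NumberField.discr K) → NumberField.discr K ≠ -3 →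
    AddSubgroup.torsionBy (W.baseChange K).toAffine.Point (2 : ℤ) = ⊥ →
    SatisfiesHeegnerHypothesis 2 K →
    ∀ (Dt : ModularForms.ModularParametrizationData W (W.conductorNorm ℤ)) (β : ℤ) (ι : K →+* ℂ),
      (4 * (W.conductorNorm ℤ : ℤ)) ∣ β ^ 2 - NumberField.discr K →
    ∀ [(W.quadraticTwist (NumberField.discr K : ℚ)).IsElliptic],
      W.selmerCorank 2 + (W.quadraticTwist (NumberField.discr K : ℚ)).selmerCorank 2 = 1 →
    ∃ r m : ℕ, ∀ M : ℕ, m < M →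
      ∃ (n : ℕ) (d : KolyvaginHeegnerData Dt β ι n),
        KolyvaginDescent.KolSupp (Zhang2014.IsKolyvaginPrime (W.conductorNorm ℤ) W K 2) n ∧
        n.primeFactors.card = r ∧
        ((M : ℕ) : ℕ∞) ≤ Zhang2014.levelIndex W 2 n ∧
        (2 ^ (M - m - 1) : ℤ) • d.kolyvaginClass Nat.prime_two M ≠ 0

/-- **HNT|c1 — the rank-one 2-converse over `K` on the corank-one frames, in U1's currency**: on every corank-one frame the Kolyvagin–Heegner
datum of conductor `1` has `P(1) = y_K` of INFINITE ORDER.  This is the Heegner-point form of «`corank_{ℤ₂} Sel_{2^∞}(E/K) = 1 ⇒ y_K`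
non-torsion» for non-CM `E/ℚ` with full 2-adic image: OPEN, beyond print at `p = 2` (the printed `p`-converse theorems — Skinner, W. Zhang 2014
Thm. 1.3, Burungale–Castella–Grossi–Skinner — take `p` odd); the pen's and the critic's SAME-WALL reading (idea-crit-5 #364b/#364c): on the
habitat it is leaf-strength modulo Gross–Zagier and the rank-`0` twin inputs.  Never a Literature fact.  Pen bsd-idea-1 g19's text, token-identical.
[cite: GrossZagier1986, Thm. I.6.3 with V.§2] [cite: WZhang2014, Thm. 1.3] [cite: GrossLMS1991, §4 (4.1)] -/
@[conjecture] def HeegnerNonTorsionAtTwoCorankOne : Prop :=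
  ∀ (W : WeierstrassCurve ℚ) [W.IsElliptic] [W.IsGloballyMinimal], ¬ W.HasCM →
    (Rank1Residual.GoodOrd W 2 ∨ Rank1Residual.Mult W 2) →
    (∀ m : ℕ, W.HasSurjectiveModNGaloisRep (2 ^ m : ℕ)) →
    ∀ (K : Type) [Field K] [NumberField K], IsImaginaryQuadratic K →
    ∀ [NeZero (W.conductorNorm ℤ)],
    SatisfiesHeegnerHypothesis (W.conductorNorm ℤ) K →
    Odd (NumberField.discr K) → NumberField.discr K ≠ -3 →
    AddSubgroup.torsionBy (W.baseChange K).toAffine.Point (2 : ℤ) = ⊥ →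
    SatisfiesHeegnerHypothesis 2 K →
    ∀ (Dt : ModularForms.ModularParametrizationData W (W.conductorNorm ℤ)) (β : ℤ) (ι : K →+* ℂ),
      (4 * (W.conductorNorm ℤ : ℤ)) ∣ β ^ 2 - NumberField.discr K →
    ∀ [(W.quadraticTwist (NumberField.discr K : ℚ)).IsElliptic],
      W.selmerCorank 2 + (W.quadraticTwist (NumberField.discr K : ℚ)).selmerCorank 2 = 1 →
    ∃ d₁ : KolyvaginHeegnerData Dt β ι 1, ¬ IsOfFinAddOrder d₁.derivedPoint

/-- **V1|c1 — V1′∞ (`Theses.KolyvaginRankRigidityAtTwo.KolyvaginStrongNonzeroSystemAtTwo`, stmt-BirchSwinnertonDyer-27983) restricted to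
the corank-one frames**: the item's binders VERBATIM plus the corank-one hypothesis, same conclusion (a RICH depth `r`: for every `θ, k` a
non-zero class `c_M(n) ≠ 0` of depth `r` at a level `1 ≤ M` with index margin `θ·M + k ≤ M(n)`).  OPEN (⟸ U1|c1 + U2 `FullClassDeepeningAtTwo`:
`CorankOne.strongCorankOne_of_boundedDefectCorankOne`; ⟹ HNT|c1 given V2♭∞ `KolyvaginCorankLowerBoundAtTwoRich`:
`CorankOne.heegnerNonTorsion_of_strongCorankOne`).  It is EXACTLY what the route's `closes` consumes of V1′∞ (`CorankOne.closes_of_corankOne`).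
Pen bsd-idea-1 g19's text, token-identical. [cite: Kolyvagin1991MathAnn, §2 (2.1), Conj. 2.5] [cite: WZhang2014, Thm. 1.1] -/
@[conjecture] def KolyvaginStrongNonzeroSystemAtTwoCorankOne : Prop :=
  ∀ (W : WeierstrassCurve ℚ) [W.IsElliptic] [W.IsGloballyMinimal], ¬ W.HasCM → (Literature.NumberTheory.EllipticCurves.Rank1Residual.GoodOrd W 2 ∨ Literature.NumberTheory.EllipticCurves.Rank1Residual.Mult W 2) → (∀ m : ℕ, W.HasSurjectiveModNGaloisRep (2 ^ m : ℕ)) → ∀ (K : Type) [Field K] [NumberField K], Literature.NumberTheory.EllipticCurves.IsImaginaryQuadratic K → ∀ [NeZero (W.conductorNorm ℤ)], Literature.NumberTheory.EllipticCurves.SatisfiesHeegnerHypothesis (W.conductorNorm ℤ) K → Odd (NumberField.discr K) → NumberField.discr K ≠ -3 → AddSubgroup.torsionBy (W.baseChange K).toAffine.Point (2 : ℤ) = ⊥ → Literature.NumberTheory.EllipticCurves.SatisfiesHeegnerHypothesis 2 K → ∀ (Dt : Literature.NumberTheory.EllipticCurves.ModularForms.ModularParametrizationData W (W.conductorNorm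 ℤ)) (β : ℤ) (ι : K →+* ℂ), (4 * (W.conductorNorm ℤ : ℤ)) ∣ β ^ 2 - NumberField.discr K →
    ∀ [(W.quadraticTwist (NumberField.discr K : ℚ)).IsElliptic],
      W.selmerCorank 2 + (W.quadraticTwist (NumberField.discr K : ℚ)).selmerCorank 2 = 1 →
    ∃ r : ℕ, ∀ θ k : ℕ, ∃ (n : ℕ) (d : Literature.NumberTheory.EllipticCurves.KolyvaginHeegnerData Dt β ι n) (M : ℕ), Literature.NumberTheory.EllipticCurves.KolyvaginDescent.KolSupp (Literature.NumberTheory.EllipticCurves.Zhang2014.IsKolyvaginPrime (W.conductorNorm ℤ) W K 2) n ∧ n.primeFactors.card = r ∧ 1 ≤ M ∧ ((θ * M + k : ℕ) : ℕ∞) ≤ Literature.NumberTheory.EllipticCurves.Zhang2014.levelIndex W 2 n ∧ d.kolyvaginClass Nat.prime_two M ≠ 0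

end Summit.BirchSwinnertonDyer.BirchSwinnertonDyer.Theorems.KolyvaginAtTwo.CorankOne

end
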